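import Summits.NavierStokesRegularity.NavierStokesRegularity.Theorems.QuantisedSymmetryPolyhedralDssProfileExistsStubGaussianEnstrophyIdentity
import Literature.Analysis.FluidPDE.CurlFreeLiouville
import HarnessLib

/-!
# Strict sign of the head-pressure pumping of a periodic Leray orbit — crux
  stmt-NavierStokesRegularity-1404 (`QuantisedSymmetry.PolyhedralDssProfileExists`), line
  polyhedral_cell, stub stub_headPressurePumping (N14)

Registered stub `stub_headPressurePumping` (`--supports stmt-NavierStokesRegularity-1404`).
Let `(U, P)` be a classical solution of the backward Leray system
`∂ₛU + ½U + ½(y·∇)U + (U·∇)U + ∇P = ΔU`, `div U = 0` on `ℝ × ℝ³` (`IsBackwardLeraySolutionOn univ 1`),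
`S`-periodic in `s` (`S > 0`), with polynomial bounds on `U`, `DU`, `∂ₛU`, `P`, `∇P`, the Type-I
profile bound `(1 + |y|)|U(s, y)| ≤ C₀`, and `U ≢ 0`. Then, with `w₀ = e^{−|y|²/4}` and the head
pressure `Π̃ = P + ½|U|² + ½ y·U`, the pumping integral is STRICTLY negative:

  `I := ∫₀^S ∫ w₀ Π̃ (y·U) dy ds < 0`.

Proof. By the Gaussian enstrophy identity of stub N10 (`stub_gaussianEnstrophyIdentity`),
`E := ∫₀^S ∫ w₀ |curl U|² = −½ I`, so `I = −2E` and it suffices to show `E > 0`. The slice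
enstrophy `a(s) = ∫ w₀ |curl U(s)|²` is nonnegative and continuous in `s` (dominated convergence with
the `s`-uniform majorant `(1 + |y|)^{4N+4} w₀` of `gaussEnstrophy_bounds`,
`pumping_continuous_enstrophy`). If `E = ∫₀^S a ≤ 0` then `a ≡ 0` on `(0, S]`
(`pumping_eq_zero_of_integral_nonpos`); a slice with `a(s) = 0` is irrotational (continuous
nonnegative integrand with zero integral), divergence free, smooth and bounded by `C₀`, hence
constant by Liouville's theorem for `curl V = 0`, `div V = 0`
(`eq_of_curl_eq_zero_of_isDivFree_of_bounded`), and the constant vanishes by the profile bound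
`|U(s, y)| ≤ C₀/(1 + |y|) → 0` (`pumping_eq_zero_of_const`, `pumping_slice_eq_zero`). By periodicity
every slice is one of the slices `s ∈ (0, S]`, so `U ≡ 0`, contradicting `U ≢ 0`
(`pumping_enstrophy_pos`).

## References

* B. Pineau, V. Vicol, arXiv:2607.09619 (2026), (5.4), (7.7)–(7.10). [PineauVicol2026]
* T.-P. Tsai, ARMA 143 (1998), (1.7). [Tsai1998]
-/

noncomputable section

-- the summit namespace `…NavierStokesRegularity.NavierStokesRegularity…` is the tree convention (D-0017)
set_option linter.dupNamespace false

namespace Summit.NavierStokesRegularity.NavierStokesRegularity.Theorems.PolyhedralDssProfileExists.PolyhedralCell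

open MeasureTheory Set Function Filter Topology
open Literature.Analysis Literature.Analysis.FluidPDE
open scoped InnerProductSpace RealInnerProductSpace Laplacian ContDiff

section Pumping

variable {U : ℝ → EuclideanSpace ℝ (Fin 3) → EuclideanSpace ℝ (Fin 3)}
  {P : ℝ → EuclideanSpace ℝ (Fin 3) → ℝ} {K : ℝ} {N : ℕ}

/-! ### A continuous nonnegative function with nonpositive integral vanishes -/

/-- A continuous nonnegative function `a` on `ℝ` with `∫₀^S a ≤ 0`, `S > 0`, vanishes on `(0, S]`:
the integral is then `0`, so `a = 0` a.e. on `(0, S]`, hence everywhere there by continuity.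
[folklore] -/
theorem pumping_eq_zero_of_integral_nonpos {a : ℝ → ℝ} {S : ℝ} (hS : 0 < S) (hac : Continuous a)
    (ha0 : ∀ s, 0 ≤ a s) (hle : ∫ s in (0 : ℝ)..S, a s ≤ 0) {s : ℝ} (hs : s ∈ Ioc 0 S) :
    a s = 0 := by
  have hai : IntervalIntegrable a volume 0 S := hac.intervalIntegrable 0 S
  have hE0 : ∫ s in (0 : ℝ)..S, a s = 0 :=
    le_antisymm hle (intervalIntegral.integral_nonneg hS.le fun s _ => ha0 s)
  have hae : a =ᵐ[volume.restrict (Ioc 0 S)] 0 :=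
    (intervalIntegral.integral_eq_zero_iff_of_le_of_nonneg_ae hS.le
      (Eventually.of_forall fun s => ha0 s) hai).1 hE0
  exact Measure.eqOn_Ioc_of_ae_eq volume hae hac.continuousOn continuousOn_const hs

/-! ### A profile-bounded constant field vanishes -/

/-- **A constant field with the Type-I profile bound vanishes.** If `V` is constant and
`(1 + |y|)|V(y)| ≤ C₀` for all `y`, then `V = 0`: read the bound at `y = R e₀` with
`R = C₀/|V(y)|`. [folklore] -/
theorem pumping_eq_zero_of_const {V : EuclideanSpace ℝ (Fin 3) → EuclideanSpace ℝ (Fin 3)} {C₀ : ℝ}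
    (hb : ∀ y, (1 + ‖y‖) * ‖V y‖ ≤ C₀) (hconst : ∀ x y, V x = V y) : V = 0 := by
  funext y
  by_contra hy
  set m : ℝ := ‖V y‖ with hm
  have hm0 : 0 < m := norm_pos_iff.2 hy
  set R : ℝ := C₀ / m with hR
  set x : EuclideanSpace ℝ (Fin 3) := R • EuclideanSpace.single 0 (1 : ℝ) with hx
  have hxn : ‖x‖ = |R| := by
    rw [hx, norm_smul, PiLp.norm_single, norm_one, mul_one, Real.norm_eq_abs]
  have key : (1 + ‖x‖) * m ≤ C₀ := by
    rw [hm, ← hconst x y]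
    exact hb x
  have e : R * m = C₀ := by rw [hR, div_mul_cancel₀ _ hm0.ne']
  have hRabs : R ≤ |R| := le_abs_self R
  rw [hxn] at key
  nlinarith [mul_le_mul_of_nonneg_right hRabs hm0.le]

/-! ### A slice with zero Gaussian enstrophy vanishes -/

/-- **A slice with zero Gaussian enstrophy vanishes.** For a classical solution of the backward
Leray system on `ℝ × ℝ³` with the polynomial bounds of stub N10 and the profile bound
`(1 + |y|)|U(s, y)| ≤ C₀`: if `∫ w₀ |curl U(s)|² = 0` then `U(s) = 0`. The integrand is continuous,
nonnegative and integrable, so it vanishes identically and `curl U(s) ≡ 0` (`w₀ > 0`); the slice is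
`C^∞`, divergence free and bounded by `C₀`, hence constant (Liouville for `curl V = 0`, `div V = 0`,
`eq_of_curl_eq_zero_of_isDivFree_of_bounded`), and the constant is `0`
(`pumping_eq_zero_of_const`). [folklore] -/
theorem pumping_slice_eq_zero (h : IsBackwardLeraySolutionOn Set.univ 1 U P)
    (hK : ∀ s y, ‖U s y‖ ≤ K * (1 + ‖y‖) ^ N ∧ ‖fderiv ℝ (U s) y‖ ≤ K * (1 + ‖y‖) ^ N ∧
      ‖timeDeriv U s y‖ ≤ K * (1 + ‖y‖) ^ N ∧ |P s y| ≤ K * (1 + ‖y‖) ^ N ∧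
      ‖gradient (P s) y‖ ≤ K * (1 + ‖y‖) ^ N)
    {C₀ : ℝ} (hC₀ : ∀ s y, (1 + ‖y‖) * ‖U s y‖ ≤ C₀) {s : ℝ}
    (h0 : ∫ y, gaussProfile (-(1 / 4 : ℝ)) y * ‖curl (U s) y‖ ^ 2 = 0) : U s = 0 := by
  have hU : ContDiff ℝ ∞ (U s) := h.contDiff_velocity (mem_univ s)
  have hU1 : ContDiff ℝ 1 (U s) := hU.of_le (by norm_cast)
  have hU2 : ContDiff ℝ 2 (U s) := hU.of_le (by norm_cast)
  have hgc : Continuous (gaussProfile (E := EuclideanSpace ℝ (Fin 3)) (-(1 / 4 : ℝ))) :=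
    (contDiff_gaussProfile (E := EuclideanSpace ℝ (Fin 3)) (-(1 / 4 : ℝ)) (n := 0)).continuous
  have cΩ : Continuous fun y => gaussProfile (-(1 / 4 : ℝ)) y * ‖curl (U s) y‖ ^ 2 :=
    hgc.mul ((continuous_curl hU1).norm.pow 2)
  have iΩ : Integrable fun y => gaussProfile (-(1 / 4 : ℝ)) y * ‖curl (U s) y‖ ^ 2 :=
    gaussEnstrophy_integrable_of_le cΩ fun y => (gaussEnstrophy_bounds h hK s y).1
  have hnn : ∀ y, 0 ≤ gaussProfile (-(1 / 4 : ℝ)) y * ‖curl (U s) y‖ ^ 2 := fun y =>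
    mul_nonneg (Real.exp_pos _).le (sq_nonneg _)
  have hae : (fun y => gaussProfile (-(1 / 4 : ℝ)) y * ‖curl (U s) y‖ ^ 2) =ᵐ[volume] 0 :=
    (integral_eq_zero_iff_of_nonneg (fun y => hnn y) iΩ).1 h0
  have hzero : (fun y => gaussProfile (-(1 / 4 : ℝ)) y * ‖curl (U s) y‖ ^ 2) = 0 :=
    (cΩ.ae_eq_iff_eq volume continuous_const).1 hae
  have hcurl : ∀ y, curl (U s) y = 0 := fun y => by
    have hy := congrFun hzero y
    have hg0 : 0 < gaussProfile (-(1 / 4 : ℝ)) y := Real.exp_pos _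
    have h2 : ‖curl (U s) y‖ ^ 2 = 0 := by
      rcases mul_eq_zero.1 hy with h1 | h1
      · exact absurd h1 hg0.ne'
      · exact h1
    exact norm_eq_zero.1 ((pow_eq_zero_iff two_ne_zero).1 h2)
  have hbd : ∀ y, ‖U s y‖ ≤ C₀ := fun y => by
    have h1 := hC₀ s y
    have h2 : ‖U s y‖ ≤ (1 + ‖y‖) * ‖U s y‖ :=
      le_mul_of_one_le_left (norm_nonneg _) (by linarith [norm_nonneg y])
    exact h2.trans h1
  exact pumping_eq_zero_of_const (hC₀ s)
    (eq_of_curl_eq_zero_of_isDivFree_of_bounded hU2 hcurl (h.divFree s (mem_univ s)) hbd)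

/-! ### Continuity of the Gaussian enstrophy in the similarity time -/

/-- **The slice enstrophy `s ↦ ∫ w₀ |curl U(s)|²` is continuous** for a classical solution of the
backward Leray system on `ℝ × ℝ³` with the polynomial bounds of stub N10: the integrand is jointly
continuous in `(s, y)` (`DU` is jointly smooth) and dominated, uniformly in `s`, by the integrable
`‖curlCLM‖²(|K| + 1)⁴ (1 + |y|)^{4(N+1)} w₀` (`gaussEnstrophy_bounds`); dominated convergence.
[folklore] -/
theorem pumping_continuous_enstrophy (h : IsBackwardLeraySolutionOn Set.univ 1 U P)
    (hK : ∀ s y, ‖U s y‖ ≤ K * (1 + ‖y‖) ^ N ∧ ‖fderiv ℝ (U s) y‖ ≤ K * (1 + ‖y‖) ^ N ∧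
      ‖timeDeriv U s y‖ ≤ K * (1 + ‖y‖) ^ N ∧ |P s y| ≤ K * (1 + ‖y‖) ^ N ∧
      ‖gradient (P s) y‖ ≤ K * (1 + ‖y‖) ^ N) :
    Continuous fun s => ∫ y, gaussProfile (-(1 / 4 : ℝ)) y * ‖curl (U s) y‖ ^ 2 := by
  have hgc : Continuous (gaussProfile (E := EuclideanSpace ℝ (Fin 3)) (-(1 / 4 : ℝ))) :=
    (contDiff_gaussProfile (E := EuclideanSpace ℝ (Fin 3)) (-(1 / 4 : ℝ)) (n := 0)).continuous
  -- joint continuity of `DU`, hence of the integrand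
  have hDUc : Continuous fun p : ℝ × EuclideanSpace ℝ (Fin 3) => fderiv ℝ (U p.1) p.2 := by
    have h' := h.smooth_velocity.isSmoothSpaceTimeOn_fderiv_of_isOpen isOpen_univ
    rw [IsSmoothSpaceTimeOn, univ_prod_univ, contDiffOn_univ] at h'
    exact h'.continuous
  have hF : Continuous fun p : ℝ × EuclideanSpace ℝ (Fin 3) =>
      gaussProfile (-(1 / 4 : ℝ)) p.2 * ‖curl (U p.1) p.2‖ ^ 2 :=
    (hgc.comp continuous_snd).mul ((curlCLM.continuous.comp hDUc).norm.pow 2)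
  have hmeas : ∀ s, AEStronglyMeasurable
      (fun y => gaussProfile (-(1 / 4 : ℝ)) y * ‖curl (U s) y‖ ^ 2) volume := fun s =>
    (hF.comp (Continuous.prodMk_right s) :).aestronglyMeasurable
  have hcont : ∀ y, Continuous fun s => gaussProfile (-(1 / 4 : ℝ)) y * ‖curl (U s) y‖ ^ 2 :=
    fun y => (hF.comp (Continuous.prodMk_left y) :)
  have hbound : ∀ s, ∀ᵐ y ∂(volume : Measure (EuclideanSpace ℝ (Fin 3))),
      ‖gaussProfile (-(1 / 4 : ℝ)) y * ‖curl (U s) y‖ ^ 2‖ ≤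
        (‖curlCLM‖ ^ 2 * (|K| + 1) ^ 4) *
          ((1 + ‖y‖) ^ (4 * (N + 1)) * gaussProfile (-(1 / 4 : ℝ)) y) := fun s =>
    Eventually.of_forall fun y => by
      rw [Real.norm_eq_abs]
      exact (gaussEnstrophy_bounds h hK s y).1
  have hint : Integrable (fun y : EuclideanSpace ℝ (Fin 3) => (‖curlCLM‖ ^ 2 * (|K| + 1) ^ 4) *
      ((1 + ‖y‖) ^ (4 * (N + 1)) * gaussProfile (-(1 / 4 : ℝ)) y)) :=
    (PineauVicol2026.integrable_one_add_norm_pow_mul_exp_neg_mul_sq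
      (E := EuclideanSpace ℝ (Fin 3)) (c := 1 / 4) (by norm_num) (4 * (N + 1))).const_mul _
  exact continuous_of_dominated
    (F := fun s y => gaussProfile (-(1 / 4 : ℝ)) y * ‖curl (U s) y‖ ^ 2) hmeas hbound hint
    (Eventually.of_forall hcont)

/-! ### Positivity of the Gaussian enstrophy of a nontrivial periodic orbit -/

/-- **The Gaussian enstrophy of a nontrivial periodic Leray orbit is positive.** For an
`S`-periodic (`S > 0`) classical solution of the backward Leray system on `ℝ × ℝ³` with the
polynomial bounds of stub N10, the profile bound `(1 + |y|)|U| ≤ C₀` and `U ≢ 0`: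
`0 < ∫₀^S ∫ w₀ |curl U|²`. Otherwise the continuous nonnegative slice enstrophy vanishes on
`(0, S]` (`pumping_eq_zero_of_integral_nonpos`, `pumping_continuous_enstrophy`), every such slice
vanishes (`pumping_slice_eq_zero`), and by periodicity `U ≡ 0`. [cite: Tsai1998, (1.7)] -/
theorem pumping_enstrophy_pos {S : ℝ} (hS : 0 < S) (h : IsBackwardLeraySolutionOn Set.univ 1 U P)
    (hper : Function.Periodic U S)
    (hK : ∀ s y, ‖U s y‖ ≤ K * (1 + ‖y‖) ^ N ∧ ‖fderiv ℝ (U s) y‖ ≤ K * (1 + ‖y‖) ^ N ∧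
      ‖timeDeriv U s y‖ ≤ K * (1 + ‖y‖) ^ N ∧ |P s y| ≤ K * (1 + ‖y‖) ^ N ∧
      ‖gradient (P s) y‖ ≤ K * (1 + ‖y‖) ^ N)
    {C₀ : ℝ} (hC₀ : ∀ s y, (1 + ‖y‖) * ‖U s y‖ ≤ C₀) (hne : ∃ s y, U s y ≠ 0) :
    0 < ∫ s in (0 : ℝ)..S, ∫ y, gaussProfile (-(1 / 4 : ℝ)) y * ‖curl (U s) y‖ ^ 2 := by
  have ha0 : ∀ s, 0 ≤ ∫ y, gaussProfile (-(1 / 4 : ℝ)) y * ‖curl (U s) y‖ ^ 2 := fun s =>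
    integral_nonneg fun y => mul_nonneg (Real.exp_pos _).le (sq_nonneg _)
  by_contra hle
  have hzero : ∀ s, U s = 0 := fun s => by
    obtain ⟨s', hs', he⟩ := hper.exists_mem_Ioc hS s 0
    rw [zero_add] at hs'
    rw [he]
    exact pumping_slice_eq_zero h hK hC₀ (pumping_eq_zero_of_integral_nonpos hS
      (pumping_continuous_enstrophy h hK) ha0 (not_lt.1 hle) hs')
  obtain ⟨s, y, hsy⟩ := hne
  exact hsy (by rw [hzero s]; rfl)

end Pumping

/-! ### The registered stub -/

/-- **Stub N14 — strict sign of the head-pressure pumping.** Let `(U, P)` be a classical solution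
of the backward Leray system `∂ₛU + ½U + ½(y·∇)U + (U·∇)U + ∇P = ΔU`, `div U = 0` on `ℝ × ℝ³`,
`S`-periodic in `s` (`S > 0`), with polynomial bounds on `U`, `DU`, `∂ₛU`, `P`, `∇P`, the profile
bound `(1 + |y|)|U(s, y)| ≤ C₀`, and `U ≢ 0`. Then, with `w₀(y) = e^{−|y|²/4}` and
`Π̃ = P + ½|U|² + ½ y·U`, `∫₀^S ∫ w₀ Π̃ (y·U) dy ds < 0`: by the Gaussian enstrophy identity
`∫₀^S ∫ w₀ |curl U|² = −½ ∫₀^S ∫ w₀ Π̃ (y·U)` (`stub_gaussianEnstrophyIdentity`) and the positivity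
of the enstrophy of a nontrivial periodic orbit (`pumping_enstrophy_pos`: a slice with zero
Gaussian enstrophy is irrotational, divergence free and bounded, hence constant by Liouville, hence
`0` by the profile bound; periodicity). [cite: PineauVicol2026, (5.4)] -/
theorem stub_headPressurePumping :
    ∀ (U : ℝ → EuclideanSpace ℝ (Fin 3) → EuclideanSpace ℝ (Fin 3)) (P : ℝ → EuclideanSpace ℝ (Fin 3) → ℝ)
      (S C₀ : ℝ), 0 < S → IsBackwardLeraySolutionOn Set.univ 1 U P → Function.Periodic U S →
      (∃ K : ℝ, ∃ N : ℕ, ∀ s y,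
          ‖U s y‖ ≤ K * (1 + ‖y‖) ^ N ∧ ‖fderiv ℝ (U s) y‖ ≤ K * (1 + ‖y‖) ^ N ∧
          ‖timeDeriv U s y‖ ≤ K * (1 + ‖y‖) ^ N ∧ |P s y| ≤ K * (1 + ‖y‖) ^ N ∧
          ‖gradient (P s) y‖ ≤ K * (1 + ‖y‖) ^ N) →
      (∀ s y, (1 + ‖y‖) * ‖U s y‖ ≤ C₀) → (∃ s y, U s y ≠ 0) →
      ∫ s in (0 : ℝ)..S, ∫ y, Real.exp (-‖y‖ ^ 2 / 4) *
          ((P s y + ‖U s y‖ ^ 2 / 2 + ⟪y, U s y⟫_ℝ / 2) * ⟪y, U s y⟫_ℝ) < 0 := by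
  intro U P S C₀ hS h hper hbd hC₀ hne
  -- the Gaussian enstrophy identity of stub N10: `E = −½ I`
  have hId := stub_gaussianEnstrophyIdentity U P S hS h hper hbd
  obtain ⟨K, N, hK⟩ := hbd
  -- the weight is the tree's `gaussProfile (−1/4)`
  have hw0 : ∀ y : EuclideanSpace ℝ (Fin 3), Real.exp (-‖y‖ ^ 2 / 4) = gaussProfile (-(1 / 4 : ℝ)) y :=
    fun y => by
    simp only [gaussProfile]
    congr 1
    ring
  simp only [hw0] at hId
  simp only [hw0]
  -- `E > 0`, hence `I = −2E < 0`
  have hpos := pumping_enstrophy_pos hS h hper hK hC₀ hne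
  linarith
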